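import Literature.NumberTheory.BeurlingPrimes.DMVContinuation
import Mathlib.Analysis.MellinTransform
import Mathlib.NumberTheory.SmoothNumbers
import HarnessLib

/-!
# Weighted exponential sums over the rational primes and the continuation of `Σ_p c(p) p^{−s}`

Topic `Literature/NumberTheory/BeurlingPrimes`, grouping namespace `PrimeWeight` (the object: a real weight
`c(p)`, `|c(p)| ≤ 1`, on the rational primes). Everything in this file is PROVED.

This is the analytic-continuation step of Broucke–Debruyne–Révész (arXiv:2309.01567, §5 p. 16) for the
random prime deletion `𝒫_𝒮 ⊂ ℙ` with `P(p ∈ 𝒫_𝒮) = p^{α−1}`: "Via integration by parts … and the adjusted estimate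
`Σ_{p_j ≤ x} p_j^{−it} − ∫₁ˣ u^{−it} dF(u) ≪ x^{α/2} + x^{α/2}√(log(|t|+1)/log(x+1))`, one obtains that on each
half-plane `Re s ≥ α/2 + ε`, `log ζ_𝒮(s) = … = ∫₁^∞ u^{−s} dF(u) + O_ε(√log|t|)`", written — exactly as
Diamond–Montgomery–Vorhauer (2006, Lemma 10) and Broucke–Vindas (2024, proof of Thm. 3.1; tree
`BVContinuation.lean`) do — as an Abel summation / Mellin transform argument, here for a GENERAL bounded weight
`c` on the primes (in §5, `c(p) = 1_𝒮(p) − p^{α−1}`) and a GENERAL exponent `θ` (in §5, `θ = α/2`):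

* `primesUpTo x`, the weighted twisted prime sum `wsum c x t = Σ_{p ≤ x} c(p) p^{−it}` and the weighted count
  `wcount c x = Σ_{p ≤ x} c(p)`;
* the Abel identity `Σ_{p ≤ X} c(p) p^{−it} p^{−w} = wsum(X,t) X^{−w} + w ∫₁^X wsum(v,t) v^{−w−1} dv`
  (`abel_identity`) and its limit `X → ∞` (`tsum_eq_mul_errMellin`): for `Re w > 1`,
  `Σ'_p c(p) p^{−(w+it)} = w · M_t(w)`, `M_t(w) = ∫₁^∞ wsum(v,t) v^{−w−1} dv` (`errMellin`);
* under the **bound** `‖wsum c x t‖ ≤ A x^θ g(t)` (`x ≥ 1`; `0 ≤ θ < 1`, `g ≥ 1`): `M_t` is holomorphic on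
  `Re w > θ`; `W(s) := s · M₀(s)` (`cont`) is the continuation of `Σ'_p c(p) p^{−s}` to `σ > θ`
  (`differentiableOn_cont`, `cont_eq_tsum`), `W(σ+it) = σ M_t(σ)` (identity theorem, `cont_eq_re_mul_errMellin`),
  and `‖W(σ+it)‖ ≤ σ A g(t)/(σ − θ)` (`norm_cont_le`).

## References
* [BrouckeDebruyneRevesz2023] F. Broucke, G. Debruyne, Sz. Gy. Révész, *Some examples of well-behaved Beurling
  number systems*, arXiv:2309.01567, §5 p. 16 (read).
* [DiamondMontgomeryVorhauer2006] H. G. Diamond, H. L. Montgomery, U. M. A. Vorhauer, Math. Ann. 334 (2006),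
  Lemma 10 (the model argument).
* [BrouckeVindas2024] F. Broucke, J. Vindas, Math. Z. 307 (2024), proof of Theorem 3.1 (tree `BVContinuation.lean`,
  whose structure this file copies).
-/

noncomputable section

open Complex Set Filter MeasureTheory intervalIntegral
open scoped Topology

namespace Literature.NumberTheory.BeurlingPrimes

namespace PrimeWeight

open DMV.Template

/-! ### Primes up to `x` and the weighted sums -/

/-- The rational primes `p ≤ x` for REAL `x`, as a `Finset`: Mathlib's `Nat.primesLE` at `⌊x⌋₊`
(so `#(primesUpTo x) = π(⌊x⌋₊)`, `Nat.primesLE_card_eq_primeCounting`). [folklore] -/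
def primesUpTo (x : ℝ) : Finset ℕ := Nat.primesLE ⌊x⌋₊

/-- `primesUpTo x = {p < ⌊x⌋₊ + 1 | p prime}` (definitionally). [folklore] -/
theorem primesUpTo_eq_filter (x : ℝ) : primesUpTo x = (Finset.range (⌊x⌋₊ + 1)).filter Nat.Prime := rfl

/-- `#(primesUpTo x) = π(⌊x⌋₊)`. [folklore] -/
theorem card_primesUpTo (x : ℝ) : (primesUpTo x).card = Nat.primeCounting ⌊x⌋₊ :=
  Nat.primesLE_card_eq_primeCounting _

/-- `p ∈ primesUpTo x ↔ p prime ∧ p ≤ x`. [folklore] -/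
theorem mem_primesUpTo {x : ℝ} {p : ℕ} : p ∈ primesUpTo x ↔ p.Prime ∧ (p : ℝ) ≤ x := by
  rw [primesUpTo, Nat.mem_primesLE]
  constructor
  · rintro ⟨hp, hpr⟩
    refine ⟨hpr, ?_⟩
    rcases le_or_gt 0 x with hx | hx
    · exact (Nat.le_floor_iff hx).mp hp
    · exfalso
      rw [Nat.floor_of_nonpos hx.le] at hp
      exact hpr.ne_zero (Nat.le_zero.mp hp)
  · rintro ⟨hpr, hp⟩
    exact ⟨Nat.le_floor hp, hpr⟩

/-- `primesUpTo` is monotone. [folklore] -/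
theorem primesUpTo_mono {x y : ℝ} (hxy : x ≤ y) : primesUpTo x ⊆ primesUpTo y := fun p hp ↦ by
  rw [mem_primesUpTo] at hp ⊢
  exact ⟨hp.1, hp.2.trans hxy⟩

/-- `primesUpTo x = primesUpTo ⌊x⌋₊`. [folklore] -/
theorem primesUpTo_floor (x : ℝ) : primesUpTo (⌊x⌋₊ : ℝ) = primesUpTo x := by
  unfold primesUpTo
  rw [Nat.floor_natCast]

/-- For `v ≤ X`: `primesUpTo v = {p ∈ primesUpTo X | p ≤ v}`. [folklore] -/
theorem primesUpTo_eq_filter_le {v X : ℝ} (hvX : v ≤ X) :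
    primesUpTo v = (primesUpTo X).filter fun p : ℕ ↦ (p : ℝ) ≤ v := by
  ext p
  simp only [Finset.mem_filter, mem_primesUpTo]
  constructor
  · rintro ⟨hp, hv⟩; exact ⟨⟨hp, hv.trans hvX⟩, hv⟩
  · rintro ⟨⟨hp, _⟩, hv⟩; exact ⟨hp, hv⟩

/-- `#primesUpTo x ≤ x` for `x ≥ 0` (primes are `≥ 1`). [folklore] -/
theorem card_primesUpTo_le {x : ℝ} (hx : 0 ≤ x) : ((primesUpTo x).card : ℝ) ≤ x := by
  have h1 : primesUpTo x ⊆ Finset.Icc 1 ⌊x⌋₊ := fun p hp ↦ by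
    rw [primesUpTo, Nat.mem_primesLE] at hp
    exact Finset.mem_Icc.mpr ⟨hp.2.one_lt.le, hp.1⟩
  calc ((primesUpTo x).card : ℝ) ≤ ((Finset.Icc 1 ⌊x⌋₊).card : ℝ) := by exact_mod_cast Finset.card_le_card h1
    _ = ⌊x⌋₊ := by simp
    _ ≤ x := Nat.floor_le hx

variable (c : ℕ → ℝ)

/-- The **weighted twisted prime sum** `wsum c x t = Σ_{p ≤ x} c(p) p^{−it}` (BDR §5: the sums
`Σ_{p_j ≤ x} p_j^{−it}` over `𝒫_𝒮` and `∫₁ˣ u^{−it} dF(u) = Σ_{p ≤ x} p^{α−1} p^{−it}`, and their difference).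
[cite: BrouckeDebruyneRevesz2023, §5 p. 16] -/
def wsum (x t : ℝ) : ℂ := ∑ p ∈ primesUpTo x, (c p : ℂ) * (p : ℂ) ^ (-(t * I))

/-- The **weighted prime count** `wcount c x = Σ_{p ≤ x} c(p)` (`= wsum c x 0`). [cite: BrouckeDebruyneRevesz2023, §5 p. 16] -/
def wcount (x : ℝ) : ℝ := ∑ p ∈ primesUpTo x, c p

/-- `wsum c x 0 = wcount c x`. [folklore] -/
theorem wsum_zero (x : ℝ) : wsum c x 0 = (wcount c x : ℂ) := by
  unfold wsum wcount
  rw [ofReal_sum]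
  exact Finset.sum_congr rfl fun p _ ↦ by simp

/-- `wsum c x t = wsum c ⌊x⌋₊ t`. [folklore] -/
theorem wsum_floor (x t : ℝ) : wsum c (⌊x⌋₊ : ℝ) t = wsum c x t := by
  unfold wsum; rw [primesUpTo_floor]

/-- `‖wsum c x t‖ ≤ #primesUpTo x` when `|c| ≤ 1`. [folklore] -/
theorem norm_wsum_le_card (hc : ∀ p, |c p| ≤ 1) (x t : ℝ) : ‖wsum c x t‖ ≤ (primesUpTo x).card := by
  unfold wsum
  refine (norm_sum_le _ _).trans ?_
  have h : ∀ p ∈ primesUpTo x, ‖(c p : ℂ) * (p : ℂ) ^ (-(t * I))‖ ≤ 1 := fun p hp ↦ by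
    rw [norm_mul, Complex.norm_natCast_cpow_of_pos (mem_primesUpTo.mp hp).1.pos, Complex.norm_real,
      Real.norm_eq_abs]
    simpa using hc p
  exact (Finset.sum_le_sum h).trans (by simp)

/-- `‖wsum c x t‖ ≤ x` for `x ≥ 0` when `|c| ≤ 1`. [folklore] -/
theorem norm_wsum_le (hc : ∀ p, |c p| ≤ 1) {x : ℝ} (hx : 0 ≤ x) (t : ℝ) : ‖wsum c x t‖ ≤ x :=
  (norm_wsum_le_card c hc x t).trans (card_primesUpTo_le hx)

/-- `wsum c x t = 0` for `x < 2` (no primes). [folklore] -/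
theorem wsum_eq_zero_of_lt_two {x : ℝ} (hx : x < 2) (t : ℝ) : wsum c x t = 0 := by
  unfold wsum
  have : primesUpTo x = ∅ := Finset.eq_empty_of_forall_notMem fun p hp ↦ by
    rw [mem_primesUpTo] at hp
    have := hp.1.two_le
    have : (2 : ℝ) ≤ p := by exact_mod_cast this
    linarith
  rw [this, Finset.sum_empty]

/-- `v ↦ wsum c v t` is measurable (it factors through `⌊v⌋₊`). [folklore] -/
theorem measurable_wsum (t : ℝ) : Measurable fun v : ℝ ↦ wsum c v t := by
  have h : (fun v : ℝ ↦ wsum c v t) = (fun n : ℕ ↦ wsum c (n : ℝ) t) ∘ Nat.floor := by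
    funext v; simp [wsum_floor]
  rw [h]
  exact (measurable_from_nat (f := fun n : ℕ ↦ wsum c (n : ℝ) t)).comp Nat.measurable_floor

/-- `v ↦ wsum c v t · v^r` is interval integrable on `[1, X]`. [folklore] -/
theorem intervalIntegrable_wsum_mul_cpow (hc : ∀ p, |c p| ≤ 1) (t : ℝ) {X : ℝ} (hX : 1 ≤ X) (r : ℂ) :
    IntervalIntegrable (fun v : ℝ ↦ wsum c v t * (v : ℂ) ^ r) volume 1 X := by
  have hm : AEStronglyMeasurable (fun v : ℝ ↦ wsum c v t * (v : ℂ) ^ r) (volume.restrict (Set.uIoc 1 X)) :=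
    ((measurable_wsum c t).mul ((Complex.measurable_ofReal.comp measurable_id).pow_const _)).aestronglyMeasurable
  refine ((intervalIntegrable_cpow' one_pos hX r).const_mul (X : ℂ)).mono_fun hm ?_
  rw [Filter.EventuallyLE, ae_restrict_iff' measurableSet_uIoc]
  refine Eventually.of_forall fun v hv ↦ ?_
  rw [uIoc_of_le hX] at hv
  rw [norm_mul, norm_mul, Complex.norm_real, Real.norm_eq_abs, abs_of_pos (by linarith [hv.1])]
  refine mul_le_mul_of_nonneg_right ?_ (norm_nonneg _)
  exact (norm_wsum_le c hc (by linarith [hv.1]) t).trans hv.2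

/-! ### The Abel identity -/

/-- **Abel summation**: for `X ≥ 1`, real `t` and complex `w`,
`Σ_{p ≤ X} c(p) p^{−it} p^{−w} = wsum(X,t) X^{−w} + w ∫₁^X wsum(v,t) v^{−w−1} dv`.
[cite: BrouckeDebruyneRevesz2023, §5 p. 16 ("Via integration by parts")] -/
theorem abel_identity {X : ℝ} (hX : 1 ≤ X) (t : ℝ) (w : ℂ) :
    ∑ p ∈ primesUpTo X, (c p : ℂ) * (p : ℂ) ^ (-(t * I)) * (p : ℂ) ^ (-w) =
      wsum c X t * (X : ℂ) ^ (-w) + w * ∫ v in (1 : ℝ)..X, wsum c v t * (v : ℂ) ^ (-w - 1) := by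
  have hle : ∀ p ∈ primesUpTo X, (1 : ℝ) ≤ p ∧ (p : ℝ) ≤ X := fun p hp ↦ by
    rw [mem_primesUpTo] at hp
    exact ⟨by exact_mod_cast hp.1.one_lt.le, hp.2⟩
  -- termwise Abel
  have h1 : ∀ p ∈ primesUpTo X,
      (c p : ℂ) * (p : ℂ) ^ (-(t * I)) * (p : ℂ) ^ (-w) =
        (c p : ℂ) * (p : ℂ) ^ (-(t * I)) * (X : ℂ) ^ (-w) +
          w * ∫ v in (1 : ℝ)..X, (if (p : ℝ) ≤ v then (c p : ℂ) * (p : ℂ) ^ (-(t * I)) else 0) *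
            (v : ℂ) ^ (-w - 1) := by
    intro p hp
    have h := term_abel (hle p hp).1 (hle p hp).2 ((c p : ℂ) * (p : ℂ) ^ (-(t * I))) w
    simpa only [ofReal_natCast] using h
  rw [Finset.sum_congr rfl h1, Finset.sum_add_distrib, ← Finset.sum_mul, ← Finset.mul_sum]
  unfold wsum
  congr 1
  congr 1
  have hint : ∀ p ∈ primesUpTo X, IntervalIntegrable
      (fun v : ℝ ↦ (if (p : ℝ) ≤ v then (c p : ℂ) * (p : ℂ) ^ (-(t * I)) else 0) * (v : ℂ) ^ (-w - 1))
      volume 1 X := fun p _ ↦ intervalIntegrable_ite_mul_cpow one_pos hX (p := fun v ↦ (p : ℝ) ≤ v)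
        measurableSet_Ici _ _
  rw [← integral_finsetSum hint]
  refine integral_congr fun v hv ↦ ?_
  rw [uIcc_of_le hX] at hv
  show ∑ p ∈ primesUpTo X, (if (p : ℝ) ≤ v then (c p : ℂ) * (p : ℂ) ^ (-(t * I)) else 0) * (v : ℂ) ^ (-w - 1) =
    (∑ p ∈ primesUpTo v, (c p : ℂ) * (p : ℂ) ^ (-(t * I))) * (v : ℂ) ^ (-w - 1)
  rw [← Finset.sum_mul]
  congr 1
  rw [Finset.sum_ite, Finset.sum_const_zero, add_zero, primesUpTo_eq_filter_le hv.2]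

/-! ### The error transform `M_t(w) = ∫₁^∞ wsum(v,t) v^{−w−1} dv` -/

/-- `M_t(w) = ∫₁^∞ wsum(v,t) v^{−w−1} dv`. [cite: BrouckeDebruyneRevesz2023, §5 p. 16] -/
def errMellin (c : ℕ → ℝ) (t : ℝ) (w : ℂ) : ℂ :=
  ∫ v in Ioi (1 : ℝ), wsum c v t * (v : ℂ) ^ (-w - 1)

variable {c} {θ A : ℝ} {g : ℝ → ℝ}

/-- **The bound** (BDR's "adjusted estimate (eq: adjusted)" in abstract form): `‖wsum c x t‖ ≤ A x^θ g(t)` for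
`x ≥ 1`, with `0 ≤ A`, `0 ≤ θ < 1`, `g ≥ 1`. [cite: BrouckeDebruyneRevesz2023, §5 p. 16 (eq: adjusted)] -/
structure IsBounded (c : ℕ → ℝ) (θ A : ℝ) (g : ℝ → ℝ) : Prop where
  abs_le : ∀ p, |c p| ≤ 1
  nonneg : 0 ≤ A
  exp_nonneg : 0 ≤ θ
  exp_lt_one : θ < 1
  one_le : ∀ t, 1 ≤ g t
  bound : ∀ x : ℝ, 1 ≤ x → ∀ t : ℝ, ‖wsum c x t‖ ≤ A * x ^ θ * g t

/-- Integrability of `wsum(v,t) v^{−w−1}` on `(1, ∞)` for `Re w > θ`. [cite: BrouckeDebruyneRevesz2023, §5 p. 16] -/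
theorem integrableOn_wsum_mul_cpow (h : IsBounded c θ A g) (t : ℝ) {w : ℂ} (hw : θ < w.re) :
    IntegrableOn (fun v : ℝ ↦ wsum c v t * (v : ℂ) ^ (-w - 1)) (Ioi 1) := by
  have hmeas : AEStronglyMeasurable (fun v : ℝ ↦ wsum c v t * (v : ℂ) ^ (-w - 1)) (volume.restrict (Ioi 1)) :=
    ((measurable_wsum c t).mul ((Complex.measurable_ofReal.comp measurable_id).pow_const _)).aestronglyMeasurable
  have hq : θ + (-w.re - 1) < -1 := by linarith
  refine Integrable.mono' (((integrableOn_Ioi_rpow_of_lt hq one_pos)).const_mul (A * g t)) hmeas ?_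
  rw [ae_restrict_iff' measurableSet_Ioi]
  refine Eventually.of_forall fun v hv ↦ ?_
  have hv1 : (1 : ℝ) < v := hv
  have hv0 : 0 < v := lt_trans one_pos hv1
  rw [norm_mul, norm_cpow_eq_rpow_re_of_pos hv0, Real.rpow_add hv0]
  simp only [sub_re, neg_re, one_re]
  have hb := h.bound v hv1.le t
  have hr : 0 ≤ v ^ (-w.re - 1) := (Real.rpow_pos_of_pos hv0 _).le
  calc ‖wsum c v t‖ * v ^ (-w.re - 1) ≤ A * v ^ θ * g t * v ^ (-w.re - 1) := mul_le_mul_of_nonneg_right hb hr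
    _ = A * g t * (v ^ θ * v ^ (-w.re - 1)) := by ring

/-- `wsum(X,t) X^{−w} → 0` as `X → ∞` for `Re w > θ`. [cite: BrouckeDebruyneRevesz2023, §5 p. 16] -/
theorem tendsto_wsum_mul_cpow (h : IsBounded c θ A g) (t : ℝ) {w : ℂ} (hw : θ < w.re) :
    Tendsto (fun X : ℝ ↦ wsum c X t * (X : ℂ) ^ (-w)) atTop (𝓝 0) := by
  refine squeeze_zero_norm' (a := fun X : ℝ ↦ A * g t * X ^ (θ - w.re)) ?_ ?_
  · filter_upwards [eventually_ge_atTop (1 : ℝ)] with X hX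
    have hX0 : 0 < X := by linarith
    rw [norm_mul, norm_cpow_eq_rpow_re_of_pos hX0, neg_re, show (θ - w.re : ℝ) = θ + -w.re by ring,
      Real.rpow_add hX0]
    have hb := h.bound X hX t
    calc ‖wsum c X t‖ * X ^ (-w.re) ≤ A * X ^ θ * g t * X ^ (-w.re) :=
          mul_le_mul_of_nonneg_right hb (Real.rpow_pos_of_pos hX0 _).le
      _ = A * g t * (X ^ θ * X ^ (-w.re)) := by ring
  · have h' := (tendsto_rpow_neg_atTop (show 0 < w.re - θ by linarith)).const_mul (A * g t)
    rw [mul_zero] at h'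
    refine h'.congr fun X ↦ ?_
    congr 1; ring_nf

/-! ### `X → ∞` in the Abel identity -/

/-- The summand `n ↦ 1_{n prime} c(n) n^{−s}` of `Σ'_p c(p) p^{−s}` as a function on `ℕ`. [folklore] -/
def primeTerm (c : ℕ → ℝ) (s : ℂ) : ℕ → ℂ :=
  {p : ℕ | p.Prime}.indicator fun n ↦ (c n : ℂ) * (n : ℂ) ^ (-s)

/-- `‖primeTerm c s n‖ ≤ n^{−Re s}` when `|c| ≤ 1`. [folklore] -/
theorem norm_primeTerm_le (hc : ∀ p, |c p| ≤ 1) (s : ℂ) (n : ℕ) : ‖primeTerm c s n‖ ≤ (n : ℝ) ^ (-s.re) := by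
  unfold primeTerm
  by_cases hn : n ∈ {p : ℕ | p.Prime}
  · rw [indicator_of_mem hn, norm_mul, Complex.norm_real, Real.norm_eq_abs,
      show (n : ℂ) = ((n : ℝ) : ℂ) by simp, norm_cpow_eq_rpow_re_of_pos (by exact_mod_cast hn.pos), neg_re]
    calc |c n| * (n : ℝ) ^ (-s.re) ≤ 1 * (n : ℝ) ^ (-s.re) :=
          mul_le_mul_of_nonneg_right (hc n) (Real.rpow_nonneg (Nat.cast_nonneg n) _)
      _ = (n : ℝ) ^ (-s.re) := one_mul _
  · rw [indicator_of_notMem hn, norm_zero]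
    exact Real.rpow_nonneg (Nat.cast_nonneg n) _

/-- `Σ_n primeTerm c s n` converges absolutely for `Re s > 1`. [folklore] -/
theorem summable_primeTerm (hc : ∀ p, |c p| ≤ 1) {s : ℂ} (hs : 1 < s.re) : Summable (primeTerm c s) := by
  refine Summable.of_norm_bounded (g := fun n : ℕ ↦ (n : ℝ) ^ (-s.re)) ?_ (norm_primeTerm_le hc s)
  exact Real.summable_nat_rpow.mpr (by linarith)

/-- `Σ'_p c(p) p^{−s} = Σ'_n primeTerm c s n` (sum over the subtype of primes versus indicator sum). [folklore] -/
theorem tsum_primes_eq_tsum_primeTerm (c : ℕ → ℝ) (s : ℂ) :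
    ∑' p : Nat.Primes, (c p : ℂ) * (p : ℂ) ^ (-s) = ∑' n : ℕ, primeTerm c s n := by
  unfold primeTerm
  exact (tsum_subtype {p : ℕ | p.Prime} (fun n : ℕ ↦ (c n : ℂ) * (n : ℂ) ^ (-s)))

/-- The partial sums of `primeTerm` over `n ≤ ⌊X⌋₊` are the prime sums over `primesUpTo X`. [folklore] -/
theorem sum_range_primeTerm (c : ℕ → ℝ) (s : ℂ) (X : ℝ) :
    ∑ n ∈ Finset.range (⌊X⌋₊ + 1), primeTerm c s n = ∑ p ∈ primesUpTo X, (c p : ℂ) * (p : ℂ) ^ (-s) := by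
  unfold primeTerm
  rw [primesUpTo_eq_filter, Finset.sum_filter]
  refine Finset.sum_congr rfl fun n _ ↦ ?_
  by_cases hn : n.Prime
  · rw [if_pos hn, indicator_of_mem (show n ∈ {p : ℕ | p.Prime} from hn)]
  · rw [if_neg hn, indicator_of_notMem (show n ∉ {p : ℕ | p.Prime} from hn)]

/-- `p^{−it} p^{−w} = p^{−(w + it)}` for `p > 0`. [folklore] -/
theorem natCast_cpow_negI_mul_cpow {p : ℕ} (hp : 0 < p) (t : ℝ) (w : ℂ) :
    (p : ℂ) ^ (-(t * I)) * (p : ℂ) ^ (-w) = (p : ℂ) ^ (-(w + t * I)) := by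
  rw [← Complex.cpow_add _ _ (by exact_mod_cast hp.ne')]
  congr 1; ring

/-- **`X → ∞` in the Abel identity**: for `Re w > 1` and real `t`,
`Σ'_p c(p) p^{−(w+it)} = w · M_t(w)`. [cite: BrouckeDebruyneRevesz2023, §5 p. 16] -/
theorem tsum_eq_mul_errMellin (h : IsBounded c θ A g) (t : ℝ) {w : ℂ} (hw : 1 < w.re) :
    ∑' p : Nat.Primes, (c p : ℂ) * (p : ℂ) ^ (-(w + t * I)) = w * errMellin c t w := by
  have hθw : θ < w.re := lt_of_lt_of_le h.exp_lt_one hw.le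
  have hsum : Summable (primeTerm c (w + t * I)) := summable_primeTerm h.abs_le (by simpa using hw)
  -- the partial sums converge to the `tsum`
  have h1 : Tendsto (fun X : ℝ ↦ ∑ p ∈ primesUpTo X, (c p : ℂ) * (p : ℂ) ^ (-(t * I)) * (p : ℂ) ^ (-w)) atTop
      (𝓝 (∑' p : Nat.Primes, (c p : ℂ) * (p : ℂ) ^ (-(w + t * I)))) := by
    rw [tsum_primes_eq_tsum_primeTerm]
    have hnat : Tendsto (fun X : ℝ ↦ ⌊X⌋₊ + 1) atTop atTop :=
      (tendsto_add_atTop_nat 1).comp tendsto_nat_floor_atTop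
    have := (hsum.hasSum.tendsto_sum_nat).comp hnat
    refine this.congr fun X ↦ ?_
    simp only [Function.comp]
    rw [sum_range_primeTerm]
    refine Finset.sum_congr rfl fun p hp ↦ ?_
    rw [mul_assoc, natCast_cpow_negI_mul_cpow (mem_primesUpTo.mp hp).1.pos]
  have h3 := tendsto_wsum_mul_cpow h t hθw
  have h4 : Tendsto (fun X : ℝ ↦ ∫ v in (1 : ℝ)..X, wsum c v t * (v : ℂ) ^ (-w - 1)) atTop
      (𝓝 (errMellin c t w)) :=
    intervalIntegral_tendsto_integral_Ioi 1 (integrableOn_wsum_mul_cpow h t hθw) tendsto_id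
  have hR := h3.add (h4.const_mul w)
  rw [zero_add] at hR
  refine tendsto_nhds_unique h1 (hR.congr' ?_)
  filter_upwards [eventually_ge_atTop (1 : ℝ)] with X hX
  exact (abel_identity c hX t w).symm

/-! ### Holomorphy of `M_t` -/

/-- The Mellin kernel function `1_{(1,∞)} wsum(·,t)`. [cite: BrouckeDebruyneRevesz2023, §5 p. 16] -/
def errFn (c : ℕ → ℝ) (t : ℝ) : ℝ → ℂ := (Ioi 1).indicator fun v ↦ wsum c v t

/-- `M_t(w) = mellin (errFn t) (−w)`. [cite: BrouckeDebruyneRevesz2023, §5 p. 16] -/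
theorem errMellin_eq_mellin (c : ℕ → ℝ) (t : ℝ) (w : ℂ) : errMellin c t w = mellin (errFn c t) (-w) := by
  rw [mellin, errMellin]
  have h : (fun v : ℝ ↦ (v : ℂ) ^ (-w - 1) • errFn c t v) =
      (Ioi 1).indicator fun v ↦ wsum c v t * (v : ℂ) ^ (-w - 1) := by
    funext v
    simp only [errFn, smul_eq_mul]
    by_cases hv : v ∈ Ioi (1 : ℝ)
    · rw [indicator_of_mem hv, indicator_of_mem hv, mul_comm]
    · rw [indicator_of_notMem hv, indicator_of_notMem hv, mul_zero]
  rw [h, setIntegral_indicator measurableSet_Ioi]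
  congr 1
  rw [Measure.restrict_congr_set (show (Ioi (0 : ℝ) ∩ Ioi 1 : Set ℝ) =ᵐ[volume] Ioi 1 by
    rw [Ioi_inter_Ioi, max_eq_right zero_le_one])]

/-- `errFn t` is integrable on `(0, X]`. [cite: BrouckeDebruyneRevesz2023, §5 p. 16] -/
theorem integrableOn_errFn (hc : ∀ p, |c p| ≤ 1) (t X : ℝ) : IntegrableOn (errFn c t) (Ioc 0 X) := by
  unfold errFn
  rw [integrableOn_indicator_iff measurableSet_Ioi]
  have hsub : Ioi 1 ∩ Ioc (0 : ℝ) X ⊆ Ioc 1 X := fun v hv ↦ ⟨hv.1, hv.2.2⟩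
  refine IntegrableOn.mono_set ?_ hsub
  have hmeas : AEStronglyMeasurable (fun v ↦ wsum c v t) (volume.restrict (Ioc 1 X)) :=
    (measurable_wsum c t).aestronglyMeasurable
  rcases le_or_gt X 1 with hX | hX
  · rw [Ioc_eq_empty (by simpa using hX)]; exact integrableOn_empty
  refine Integrable.mono' (g := fun _ ↦ X) (integrableOn_const (by simp)) hmeas ?_
  rw [ae_restrict_iff' measurableSet_Ioc]
  exact Eventually.of_forall fun v hv ↦ (norm_wsum_le c hc (by linarith [hv.1]) t).trans hv.2

/-- `errFn t` is locally integrable on `(0, ∞)`. [cite: BrouckeDebruyneRevesz2023, §5 p. 16] -/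
theorem locallyIntegrableOn_errFn (hc : ∀ p, |c p| ≤ 1) (t : ℝ) : LocallyIntegrableOn (errFn c t) (Ioi 0) := by
  rw [locallyIntegrableOn_iff isOpen_Ioi.isLocallyClosed]
  intro k hk hkc
  obtain ⟨X, hX⟩ := hkc.isBounded.bddAbove
  exact (integrableOn_errFn hc t X).mono_set fun v hv ↦ ⟨hk hv, hX hv⟩

/-- `errFn t = O(v^θ)` at `∞`. [cite: BrouckeDebruyneRevesz2023, §5 p. 16] -/
theorem errFn_isBigO_top (h : IsBounded c θ A g) (t : ℝ) :
    errFn c t =O[atTop] fun v : ℝ ↦ v ^ (-(-θ)) := by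
  refine Asymptotics.IsBigO.of_bound (A * g t) ?_
  filter_upwards [eventually_gt_atTop (1 : ℝ)] with v hv
  rw [errFn, indicator_of_mem (mem_Ioi.mpr hv), neg_neg, Real.norm_eq_abs,
    abs_of_nonneg (Real.rpow_nonneg (by linarith) _)]
  calc ‖wsum c v t‖ ≤ A * v ^ θ * g t := h.bound v hv.le t
    _ = A * g t * v ^ θ := by ring

/-- `errFn t = 0` near `0⁺`. [cite: BrouckeDebruyneRevesz2023, §5 p. 16] -/
theorem errFn_isBigO_zero (c : ℕ → ℝ) (t b : ℝ) : errFn c t =O[𝓝[>] 0] fun v : ℝ ↦ v ^ (-b) := by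
  have h : errFn c t =ᶠ[𝓝[>] 0] fun _ ↦ (0 : ℂ) := by
    have : Ioo (0 : ℝ) 1 ∈ 𝓝[>] (0 : ℝ) := Ioo_mem_nhdsGT one_pos
    filter_upwards [this] with v hv
    rw [errFn, indicator_of_notMem (by simpa using hv.2.le)]
  exact (Asymptotics.isBigO_zero _ _).congr' h.symm EventuallyEq.rfl

/-- **`M_t` is holomorphic on `Re w > θ`.** [cite: BrouckeDebruyneRevesz2023, §5 p. 16] -/
theorem differentiableOn_errMellin (h : IsBounded c θ A g) (t : ℝ) :
    DifferentiableOn ℂ (errMellin c t) {w : ℂ | θ < w.re} := by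
  intro w hw
  have hdiff : DifferentiableAt ℂ (mellin (errFn c t)) (-w) :=
    mellin_differentiableAt_of_isBigO_rpow (locallyIntegrableOn_errFn h.abs_le t) (errFn_isBigO_top h t)
      (by simp only [neg_re]; simp only [mem_setOf_eq] at hw; linarith)
      (errFn_isBigO_zero c t (-w.re - 1)) (by simp only [neg_re]; linarith)
  have hfun : errMellin c t = fun w ↦ mellin (errFn c t) (-w) := funext (errMellin_eq_mellin c t)
  rw [hfun]
  exact (hdiff.comp w differentiableAt_id.neg).differentiableWithinAt

/-! ### The continuation `W(s) = s · M₀(s)` and the identity theorem -/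

/-- **`W(s) = s · M₀(s)`**, the continuation of `Σ'_p c(p) p^{−s}` to `σ > θ`. [cite: BrouckeDebruyneRevesz2023, §5 p. 16] -/
def cont (c : ℕ → ℝ) (s : ℂ) : ℂ := s * errMellin c 0 s

/-- `W` is holomorphic on `σ > θ`. [cite: BrouckeDebruyneRevesz2023, §5 p. 16] -/
theorem differentiableOn_cont (h : IsBounded c θ A g) : DifferentiableOn ℂ (cont c) {s : ℂ | θ < s.re} :=
  differentiableOn_id.mul (differentiableOn_errMellin h 0)

/-- For `σ > 1`: `W(s) = Σ'_p c(p) p^{−s}`. [cite: BrouckeDebruyneRevesz2023, §5 p. 16] -/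
theorem cont_eq_tsum (h : IsBounded c θ A g) {s : ℂ} (hs : 1 < s.re) :
    cont c s = ∑' p : Nat.Primes, (c p : ℂ) * (p : ℂ) ^ (-s) := by
  have h' := tsum_eq_mul_errMellin h 0 hs
  simp only [ofReal_zero, zero_mul, add_zero] at h'
  rw [cont, ← h']

/-- **`W(s) = (Re s) · M_{Im s}(Re s)`** for `Re s > θ` (identity theorem in `w` for fixed `Im s`: both sides are
holomorphic in `w` on `Re w > θ` and agree with `Σ'_p c(p)p^{−(w+it)}` for `Re w > 1`).
[cite: BrouckeDebruyneRevesz2023, §5 p. 16] -/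
theorem cont_eq_re_mul_errMellin (h : IsBounded c θ A g) {s : ℂ} (hs : θ < s.re) :
    cont c s = (s.re : ℂ) * errMellin c s.im s.re := by
  set t₀ : ℝ := s.im with ht₀
  set U : Set ℂ := {w : ℂ | θ < w.re} with hU
  have hUo : IsOpen U := isOpen_lt continuous_const Complex.continuous_re
  set G₁ : ℂ → ℂ := fun w ↦ cont c (w + t₀ * I) with hG₁
  set G₂ : ℂ → ℂ := fun w ↦ w * errMellin c t₀ w with hG₂
  have hG₁d : DifferentiableOn ℂ G₁ U := by
    have hmap : MapsTo (fun w : ℂ ↦ w + t₀ * I) U U := fun w hw ↦ by simpa [hU] using hw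
    exact (differentiableOn_cont h).comp (differentiableOn_id.add (differentiableOn_const _)) hmap
  have hG₂d : DifferentiableOn ℂ G₂ U := differentiableOn_id.mul (differentiableOn_errMellin h t₀)
  have hagree : ∀ w : ℂ, 1 < w.re → G₁ w = G₂ w := by
    intro w hw
    have hw' : 1 < (w + t₀ * I).re := by simpa using hw
    simp only [hG₁, hG₂]
    rw [cont_eq_tsum h hw', tsum_eq_mul_errMellin h t₀ hw]
  have hev : G₁ =ᶠ[𝓝 (2 : ℂ)] G₂ := by
    have : {w : ℂ | 1 < w.re} ∈ 𝓝 (2 : ℂ) :=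
      (isOpen_lt continuous_const Complex.continuous_re).mem_nhds (by simp)
    filter_upwards [this] with w hw using hagree w hw
  have h2U : (2 : ℂ) ∈ U := by
    rw [hU]; show θ < (2 : ℂ).re; norm_num; linarith [h.exp_lt_one]
  have heq : EqOn G₁ G₂ U :=
    (hG₁d.analyticOnNhd hUo).eqOn_of_preconnected_of_eventuallyEq (hG₂d.analyticOnNhd hUo)
      (convex_halfSpace_re_gt θ).isPreconnected h2U hev
  have hσU : (s.re : ℂ) ∈ U := by simpa [hU] using hs
  have h' := heq hσU
  simp only [hG₁, hG₂] at h'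
  rw [← h', ht₀, Complex.re_add_im]

/-! ### The bound -/

/-- **The bound for real `σ > θ`**: `‖M_t(σ)‖ ≤ A g(t)/(σ − θ)` (`∫₁^∞ v^{θ−σ−1} dv = 1/(σ−θ)`).
[cite: BrouckeDebruyneRevesz2023, §5 p. 16] -/
theorem norm_errMellin_le (h : IsBounded c θ A g) (t : ℝ) {σ : ℝ} (hσ : θ < σ) :
    ‖errMellin c t σ‖ ≤ A * g t / (σ - θ) := by
  have hq : θ + (-σ - 1) < -1 := by linarith
  set maj : ℝ → ℝ := fun v ↦ A * g t * v ^ (θ + (-σ - 1)) with hmaj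
  have hmajint : IntegrableOn maj (Ioi 1) := (integrableOn_Ioi_rpow_of_lt hq one_pos).const_mul _
  have hpt : ∀ v ∈ Ioi (1 : ℝ), ‖wsum c v t * (v : ℂ) ^ (-(σ : ℂ) - 1)‖ ≤ maj v := by
    intro v hv
    have hv1 : (1 : ℝ) < v := hv
    have hv0 : 0 < v := lt_trans one_pos hv1
    rw [norm_mul, norm_cpow_eq_rpow_re_of_pos hv0]
    simp only [sub_re, neg_re, ofReal_re, one_re]
    have hb := h.bound v hv1.le t
    have hr : 0 ≤ v ^ (-σ - 1) := (Real.rpow_pos_of_pos hv0 _).le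
    calc ‖wsum c v t‖ * v ^ (-σ - 1) ≤ A * v ^ θ * g t * v ^ (-σ - 1) := mul_le_mul_of_nonneg_right hb hr
      _ = maj v := by rw [hmaj]; simp only; rw [Real.rpow_add hv0]; ring
  unfold errMellin
  calc ‖∫ v in Ioi (1 : ℝ), wsum c v t * (v : ℂ) ^ (-(σ : ℂ) - 1)‖
      ≤ ∫ v in Ioi (1 : ℝ), ‖wsum c v t * (v : ℂ) ^ (-(σ : ℂ) - 1)‖ := norm_integral_le_integral_norm _
    _ ≤ ∫ v in Ioi (1 : ℝ), maj v :=
        setIntegral_mono_on (integrableOn_wsum_mul_cpow h t (by simpa using hσ)).norm hmajint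
          measurableSet_Ioi hpt
    _ = A * g t / (σ - θ) := by
        rw [hmaj, MeasureTheory.integral_const_mul, integral_Ioi_rpow_of_lt hq one_pos, Real.one_rpow]
        have h1 : θ + (-σ - 1) + 1 = -(σ - θ) := by ring
        rw [h1]
        have hne : σ - θ ≠ 0 := by linarith
        field_simp

/-- **The bound for `W`**: for `σ = Re s > θ`, `t = Im s`, `‖W(s)‖ ≤ σ A g(t)/(σ − θ)` (BDR: "`O_ε(√log|t|)` on
`Re s ≥ α/2 + ε`" once `g(t) = 1 + √log(|t|+2)`, `θ = α/2`). [cite: BrouckeDebruyneRevesz2023, §5 p. 16] -/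
theorem norm_cont_le (h : IsBounded c θ A g) {s : ℂ} (hs : θ < s.re) :
    ‖cont c s‖ ≤ s.re * (A * g s.im / (s.re - θ)) := by
  have hσ0 : 0 < s.re := lt_of_le_of_lt h.exp_nonneg hs
  rw [cont_eq_re_mul_errMellin h hs, norm_mul, Complex.norm_real, Real.norm_eq_abs, abs_of_pos hσ0]
  exact mul_le_mul_of_nonneg_left (norm_errMellin_le h s.im hs) hσ0.le

end PrimeWeight

end Literature.NumberTheory.BeurlingPrimes
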